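import Summits.SmoothPoincare4.SmoothPoincare4.Theorems.ConvexBisectionAcyclicBisectionExistsStabilisationData
import Mathlib.Analysis.SpecialFunctions.Complex.LogDeriv
import HarnessLib

/-!
# N3 (`stub_STgeo`) ▸ N3-nat: ANGLE AND REGION BOOKKEEPING of the stabilisation data, the model crossing
# arc, and N3-nat ⟸ the pieces (kernel-checked composition, with the top reduction to the registered text)
(wave 7, brick H6-2 of stub `stub_STgeo` = node N3 of NF4, line `modp-braid-orbits`, crux
`ConvexBisection.AcyclicBisectionExists`, item stmt-SmoothPoincare4-10508; registered sub-goal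
`helper_node_STnat_of_four`; design file `work/design/N3_Stabilisation_Design.lean` (G5, wave 6); vocabulary
`…StabilisationData.lean` (H6-1).)

* §1 the block sector is the image of an open horizontal strip under `exp`, hence OPEN
  (`blockSector_eq_image_exp`, `isOpen_blockSector`); it misses `0`; **the old directions
  `pageDir (n+4) (k+4)`, `k < n`, are OFF the block sector** (`pageDir_add_four_not_mem_blockSector`: the
  parameter `t` of such a direction is `≡ n − k − ½ (mod n+4)`, never in `(−17/4, 1/4)`); the model region is
  open (`isOpen_modelRegion`).
* §2 the model crossing arc `crossVec u s = (sin s, cos s · u)`: coordinates, `lamSq 1 = sin² s` (so it lies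
  on the belt sphere `x_λ = 0` exactly for `sin s = 0`), unit norm for `‖u‖ = 1`.
* §3 `node_STnat_of_pieces` — (ST-nat) with the natural word `natWord g c l` from the FIVE pieces N3d-1
  (`Nonempty (StabBaseData g n c)`), N3d-0 (`NormalisedDatum`), N3d-2 (cancellation), N3d-3 (rebase),
  N3d-4/5/6 (trade), entered as their closed ∀-statements VERBATIM from the design; the registered
  `helper_node_STnat_of_four` (cancellation pre-supplied to the rebase); and `stgeo_of_pieces_of_M2geo`:
  **the registered text of `stub_STgeo` from the five pieces and `stub_M2geo`** through the landed
  `StabNaturalReduction.stgeo_of_natural_of_M2geo` (p166176) — so the N3 debt is exactly the five pieces + N1.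

References: J. B. Etnyre, T. Fuller, IMRN 2006, §2 p. 5 [EtnyreFuller2006]; R. İ. Baykur, AGT 6 (2006),
Lemma 1, §5 p. 13 [Baykur2006]; A. A. Kosinski, *Differential Manifolds* (1993), VI §6–7 [Kosinski1993].
-/

noncomputable section

-- the prescribed namespace `Summit.<P>.<Sub>.…` duplicates `SmoothPoincare4` (P = Sub)
set_option linter.dupNamespace false

open scoped Manifold ContDiff Topology Real
open Set Function

namespace Summit.SmoothPoincare4.SmoothPoincare4.Theorems.AcyclicBisectionExists.ModpBraidOrbits

open Literature.GroupTheory.CombinatorialGroupTheory.SignedHurwitz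
open Literature.Topology.FourManifolds Literature.Topology.FourManifolds.LefschetzBase
open Literature.Topology.FourManifolds.HandleAttachingMap
open Literature.Geometry.Symplectic

namespace StabilisationData

/-! ## §1 The block sector: openness, and the old directions are off it -/

/-- The angular unit `2π/(n+4)` of the stabilised word is positive. [folklore] -/
theorem angUnit_pos (n : ℕ) : 0 < 2 * π / ((n + 4 : ℕ) : ℝ) := by
  have : (0 : ℝ) < ((n + 4 : ℕ) : ℝ) := by positivity
  positivity

/-- **The block sector is the image under `exp` of the open horizontal strip of heights
`2πt/(n+4)`, `t ∈ (−17/4, 1/4)`** (`r e^{iαt} = exp (log r + iαt)`). [folklore] -/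
theorem blockSector_eq_image_exp (n : ℕ) : blockSector n =
    Complex.exp '' {u : ℂ | u.im ∈ Ioo (2 * π / ((n + 4 : ℕ) : ℝ) * -(17 / 4 : ℝ))
      (2 * π / ((n + 4 : ℕ) : ℝ) * (1 / 4 : ℝ))} := by
  have hα := angUnit_pos n
  ext z
  constructor
  · rintro ⟨r, t, hr, ⟨ht1, ht2⟩, rfl⟩
    set a : ℝ := 2 * π * t / ((n + 4 : ℕ) : ℝ) with ha
    have him : ((Real.log r : ℂ) + (a : ℂ) * Complex.I).im = a := by simp
    refine ⟨(Real.log r : ℂ) + (a : ℂ) * Complex.I, ?_, ?_⟩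
    · rw [mem_setOf_eq, him, ha]
      have hN : (0 : ℝ) < ((n + 4 : ℕ) : ℝ) := by positivity
      constructor
      · rw [div_mul_eq_mul_div]; exact div_lt_div_of_pos_right (by nlinarith [Real.pi_pos]) hN
      · rw [div_mul_eq_mul_div]; exact div_lt_div_of_pos_right (by nlinarith [Real.pi_pos]) hN
    · rw [Complex.exp_add, ← Complex.ofReal_exp, Real.exp_log hr]
  · rintro ⟨u, ⟨hu1, hu2⟩, rfl⟩
    refine ⟨Real.exp u.re, u.im / (2 * π / ((n + 4 : ℕ) : ℝ)), Real.exp_pos _, ⟨?_, ?_⟩, ?_⟩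
    · rwa [lt_div_iff₀ hα, mul_comm]
    · rwa [div_lt_iff₀ hα, mul_comm]
    · have him : (2 * π * (u.im / (2 * π / ((n + 4 : ℕ) : ℝ))) / ((n + 4 : ℕ) : ℝ) : ℝ) = u.im := by
        field_simp
      rw [him, Complex.ofReal_exp, ← Complex.exp_add, Complex.re_add_im]

/-- **The block sector is open.** [folklore] -/
theorem isOpen_blockSector (n : ℕ) : IsOpen (blockSector n) := by
  rw [blockSector_eq_image_exp]
  exact Complex.isOpenMap_exp _ (isOpen_Ioo.preimage Complex.continuous_im)

/-- Points of the block sector are non-zero. [folklore] -/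
theorem ne_zero_of_mem_blockSector {n : ℕ} {z : ℂ} (hz : z ∈ blockSector n) : z ≠ 0 := by
  obtain ⟨r, t, hr, -, rfl⟩ := hz
  exact mul_ne_zero (by exact_mod_cast hr.ne') (Complex.exp_ne_zero _)

/-- `0` is not in the block sector. [folklore] -/
theorem zero_not_mem_blockSector (n : ℕ) : (0 : ℂ) ∉ blockSector n := fun h =>
  ne_zero_of_mem_blockSector h rfl

/-- **The old directions are off the block sector**: for `k < n` the direction `pageDir (n+4) (k+4)` of
the `k`-th old handle of the stabilised word has parameter `t ≡ n − k − ½ (mod n + 4)`, and no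
representative lies in `(−17/4, 1/4)` (the two candidates are `−k − 9/2 ≤ −9/2` and
`n − k − ½ ≥ ½`). [folklore] -/
theorem pageDir_add_four_not_mem_blockSector {n k : ℕ} (hk : k < n) :
    pageDir (n + 4) (k + 4) ∉ blockSector n := by
  rintro ⟨r, t, hr, ⟨ht1, ht2⟩, h⟩
  have hr1 : r = 1 := by
    have hn := congrArg norm h
    rw [norm_pageDir, norm_mul, Complex.norm_exp_ofReal_mul_I, mul_one, Complex.norm_real,
      Real.norm_eq_abs, abs_of_pos hr] at hn
    exact hn.symm
  subst hr1
  rw [Complex.ofReal_one, one_mul, pageDir, Complex.exp_eq_exp_iff_exists_int] at h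
  obtain ⟨m, hm⟩ := h
  have hN : (0 : ℝ) < ((n + 4 : ℕ) : ℝ) := by positivity
  set a : ℝ := -(2 * π * (((k + 4 : ℕ) : ℝ) + 1 / 2) / ((n + 4 : ℕ) : ℝ)) with ha
  set b : ℝ := 2 * π * t / ((n + 4 : ℕ) : ℝ) with hb
  have hre : a = b + m * (2 * π) := by
    have h2 := congrArg Complex.im hm
    simpa using h2
  -- clear denominators: `-(k + 9/2) = t + m (n + 4)`
  have key : -(((k + 4 : ℕ) : ℝ) + 1 / 2) = t + m * ((n + 4 : ℕ) : ℝ) := by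
    rw [ha, hb] at hre
    field_simp at hre
    nlinarith [hre, Real.pi_pos, hN, mul_pos Real.pi_pos hN]
  push_cast at key
  have hkn : (k : ℝ) + 1 ≤ n := by exact_mod_cast Nat.succ_le_of_lt hk
  have hk0 : (0 : ℝ) ≤ k := Nat.cast_nonneg k
  -- `m (n+4) < -k - 1/4 < 0`, so `m ≤ -1`, so `t ≥ n - k - 1/2 ≥ 1/2`: contradiction
  have hmneg : (m : ℝ) < 0 := by
    by_contra hm0
    push Not at hm0
    have : (0 : ℝ) ≤ (m : ℝ) * ((n : ℝ) + 4) := mul_nonneg hm0 (by positivity)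
    linarith
  have hm1 : (m : ℝ) ≤ -1 := by
    have : m < 0 := by exact_mod_cast hmneg
    have : m ≤ -1 := by omega
    exact_mod_cast this
  nlinarith

/-- The directions of the old letters of the natural word, as members of `Fin`: off the block sector.
[folklore] -/
theorem pageDir_natAdd_not_mem_blockSector {n : ℕ} (k : Fin n) :
    pageDir (n + 4) ((k : ℕ) + 4) ∉ blockSector n :=
  pageDir_add_four_not_mem_blockSector k.2

/-- **The model region is open** (strict inequalities on the continuous `rho`, `‖x‖²`, and `w` in the
open block sector). [folklore] -/
theorem isOpen_modelRegion (g n : ℕ) (δ₀ ε₁ : ℝ) : IsOpen (modelRegion g n δ₀ ε₁) := by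
  have hc : Continuous fun p : Base g => (p.1 : EuclideanSpace ℝ (Fin 4)) := continuous_subtype_val
  have e : modelRegion g n δ₀ ε₁ = {p : Base g | 1 / 4 - δ₀ < rho g p.1} ∩
      ({p : Base g | 4 - ε₁ < ‖cx p.1‖ ^ 2} ∪ (fun p : Base g => w g p.1) ⁻¹' blockSector n) :=
    Set.ext fun _ => Iff.rfl
  rw [e]
  exact (isOpen_lt continuous_const ((contDiff_rho g).continuous.comp hc)).inter
    ((isOpen_lt continuous_const ((continuous_norm.comp (contDiff_cx.continuous.comp hc)).pow 2)).union
      ((isOpen_blockSector n).preimage ((contDiff_w g).continuous.comp hc)))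

/-! ## §2 The model crossing arc -/

/-- Coordinate `0` of the crossing arc: `sin s` (the `x_λ`-coordinate of the model 1-handle). [folklore] -/
@[simp] theorem crossVec_apply_zero (u : EuclideanSpace ℝ (Fin 3)) (s : ℝ) : crossVec u s 0 = Real.sin s := rfl

/-- Coordinate `1` of the crossing arc. [folklore] -/
@[simp] theorem crossVec_apply_one (u : EuclideanSpace ℝ (Fin 3)) (s : ℝ) :
    crossVec u s 1 = Real.cos s * u 0 := rfl

/-- Coordinate `2` of the crossing arc. [folklore] -/
@[simp] theorem crossVec_apply_two (u : EuclideanSpace ℝ (Fin 3)) (s : ℝ) :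
    crossVec u s 2 = Real.cos s * u 1 := rfl

/-- Coordinate `3` of the crossing arc. [folklore] -/
@[simp] theorem crossVec_apply_three (u : EuclideanSpace ℝ (Fin 3)) (s : ℝ) :
    crossVec u s 3 = Real.cos s * u 2 := rfl

/-- `|x_λ|²` of the model 1-handle on `ℝ⁴ = ℝ¹ × ℝ³`: `u₀²`. [folklore] -/
theorem lamSq_one_fin_four (u : EuclideanSpace ℝ (Fin 4)) : lamSq 1 u = u 0 ^ 2 := by
  simp [lamSq, Finset.sum_filter]

/-- **The crossing arc meets the belt sphere `x_λ = 0` exactly where `sin s = 0`**: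
`lamSq 1 (crossVec u s) = sin² s`. [folklore] -/
theorem lamSq_crossVec (u : EuclideanSpace ℝ (Fin 3)) (s : ℝ) :
    lamSq 1 (crossVec u s) = Real.sin s ^ 2 := by
  rw [lamSq_one_fin_four, crossVec_apply_zero]

/-- At `s = 0` the crossing arc is on the belt sphere. [folklore] -/
theorem lamSq_crossVec_zero (u : EuclideanSpace ℝ (Fin 3)) : lamSq 1 (crossVec u 0) = 0 := by
  rw [lamSq_crossVec, Real.sin_zero]; ring

/-- Near `s = 0` (indeed for `0 < |s| < π`) the crossing arc is OFF the belt sphere. [folklore] -/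
theorem lamSq_crossVec_ne_zero (u : EuclideanSpace ℝ (Fin 3)) {s : ℝ} (hs : s ∈ Ioo (-π) π) (hs0 : s ≠ 0) :
    lamSq 1 (crossVec u s) ≠ 0 := by
  rw [lamSq_crossVec]
  refine pow_ne_zero 2 fun h => hs0 ?_
  rcases lt_or_gt_of_ne hs0 with hlt | hgt
  · have := Real.sin_neg_of_neg_of_neg_pi_lt hlt hs.1; linarith
  · have := Real.sin_pos_of_pos_of_lt_pi hgt hs.2; linarith

/-- **The crossing arc lies on the unit sphere `∂D⁴`** for a unit direction `u`:
`‖crossVec u s‖² = sin² s + cos² s ‖u‖²`. [folklore] -/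
theorem norm_crossVec_sq (u : EuclideanSpace ℝ (Fin 3)) (s : ℝ) :
    ‖crossVec u s‖ ^ 2 = Real.sin s ^ 2 + Real.cos s ^ 2 * ‖u‖ ^ 2 := by
  rw [EuclideanSpace.norm_sq_eq, EuclideanSpace.norm_sq_eq, Fin.sum_univ_four, Fin.sum_univ_three]
  simp only [Real.norm_eq_abs, sq_abs, crossVec_apply_zero, crossVec_apply_one, crossVec_apply_two,
    crossVec_apply_three]
  ring

/-- For `‖u‖ = 1` the crossing arc has norm `1`. [folklore] -/
theorem norm_crossVec {u : EuclideanSpace ℝ (Fin 3)} (hu : ‖u‖ = 1) (s : ℝ) : ‖crossVec u s‖ = 1 := by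
  have h := norm_crossVec_sq u s
  rw [hu, one_pow, mul_one, Real.sin_sq_add_cos_sq] at h
  nlinarith [norm_nonneg (crossVec u s)]

/-- The crossing arc at `s = 0` is the belt-sphere point `(0, u)`. [folklore] -/
theorem crossVec_zero (u : EuclideanSpace ℝ (Fin 3)) :
    crossVec u 0 = WithLp.toLp 2 ![0, u 0, u 1, u 2] := by
  ext i
  fin_cases i <;> simp

/-! ## §3 N3-nat from the pieces; the registered text of `stub_STgeo` from the pieces and N1 -/

/-- **N3-nat (`node_STnat`) from the FIVE pieces of the N3 design, literal composition**: N3d-1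
(`h1`, the stabilised base data exist), N3d-0 (`h0`, normalisation of a fibred datum), N3d-2 (`h2`,
cancellation of the two `(1,2)`-pairs for every model of `Base (g+1) ∪ qA ∪ qB`), N3d-3 (`h3`, the two-sided
model from a normalised datum and the cancellations), N3d-4/5/6 (`h4`, trading + duals + finish).  The
pieces enter as their closed ∀-statements VERBATIM from `work/design/N3_Stabilisation_Design.lean` §3.
[cite: EtnyreFuller2006, §2] -/
theorem node_STnat_of_pieces
    (h1 : ∀ (g n : ℕ) (c : Fin g ⊕ Fin g → ℤ), (c = 0 ∨ IsPrimitive c) → Nonempty (StabBaseData g n c))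
    (h0 : ∀ (M : Type) [TopologicalSpace M] [T2Space M] [SecondCountableTopology M]
      [ChartedSpace (EuclideanSpace ℝ (Fin 4)) M] [IsManifold (𝓡 4) ∞ M] (g : ℕ) (l : IntWord g)
      (c : Fin g ⊕ Fin g → ℤ) (S : StabBaseData g l.length c),
      ModelsOnFibred M g l → NormalisedDatum M g l S)
    (h2 : ∀ (g n : ℕ) (c : Fin g ⊕ Fin g → ℤ) (S : StabBaseData g n c)
      (V : Type) [TopologicalSpace V] [T2Space V] [SecondCountableTopology V] [CompactSpace V]
      [ChartedSpace (EuclideanHalfSpace 4) V] [IsManifold (𝓡∂ 4) ∞ V]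
      (DV : MultiAttachmentData ![S.qA, S.qB] (𝓡∂ 4) V),
      ∃ Λ : V ≃ₘ⟮𝓡∂ 4, 𝓡∂ 4⟯ Base g,
        ∀ (a : ↥(coresComplement S.q1)) (ha : S.E.jA a ∈ coresComplement ![S.qA, S.qB]),
          (a : Base g) ∉ modelRegion g n S.δ₀ S.ε₁ → Λ (DV.jA ⟨S.E.jA a, ha⟩) = (a : Base g))
    (h3 : ∀ (M : Type) [TopologicalSpace M] [T2Space M] [SecondCountableTopology M]
      [ChartedSpace (EuclideanSpace ℝ (Fin 4)) M] [IsManifold (𝓡 4) ∞ M] (g : ℕ) (l : IntWord g)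
      (c : Fin g ⊕ Fin g → ℤ) (S : StabBaseData g l.length c),
      NormalisedDatum M g l S →
      (∀ (V : Type) [TopologicalSpace V] [T2Space V] [SecondCountableTopology V] [CompactSpace V]
        [ChartedSpace (EuclideanHalfSpace 4) V] [IsManifold (𝓡∂ 4) ∞ V]
        (DV : MultiAttachmentData ![S.qA, S.qB] (𝓡∂ 4) V),
        ∃ Λ : V ≃ₘ⟮𝓡∂ 4, 𝓡∂ 4⟯ Base g,
          ∀ (a : ↥(coresComplement S.q1)) (ha : S.E.jA a ∈ coresComplement ![S.qA, S.qB]),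
            (a : Base g) ∉ modelRegion g l.length S.δ₀ S.ε₁ → Λ (DV.jA ⟨S.E.jA a, ha⟩) = (a : Base g)) →
      TwoSidedStabModel M g l S)
    (h4 : ∀ (M : Type) [TopologicalSpace M] [T2Space M] [SecondCountableTopology M]
      [ChartedSpace (EuclideanSpace ℝ (Fin 4)) M] [IsManifold (𝓡 4) ∞ M] (g : ℕ) (l : IntWord g)
      (c : Fin g ⊕ Fin g → ℤ) (S : StabBaseData g l.length c),
      TwoSidedStabModel M g l S → ModelsOnFibred M (g + 1) (natWord g c l)) :
    ∀ (M : Type) [TopologicalSpace M] [T2Space M] [SecondCountableTopology M]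
      [ChartedSpace (EuclideanSpace ℝ (Fin 4)) M] [IsManifold (𝓡 4) ∞ M] (g : ℕ) (l : IntWord g)
      (c : Fin g ⊕ Fin g → ℤ), (c = 0 ∨ IsPrimitive c) →
      ModelsOnFibred M g l → ModelsOnFibred M (g + 1) (natWord g c l) := by
  intro M _ _ _ _ _ g l c hc hM
  obtain ⟨S⟩ := h1 g l.length c hc
  exact h4 M g l c S (h3 M g l c S (h0 M g l c S hM) (fun V _ _ _ _ _ _ DV => h2 g l.length c S V DV))

/-- **The registered text of `stub_STgeo` (`work/stubs/sig_stub_STgeo.txt` VERBATIM) from the five pieces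
of N3-nat and N1 (`stub_M2geo`)**, through the landed (ST-nat) ∧ (M2-geo) ⇒ (ST-geo) reduction
`StabNaturalReduction.stgeo_of_natural_of_M2geo` (p166176; itself through the two signed Hurwitz moves
of p165085, the (HS) reduction p134969 and the belt clause N2).  Kernel-checks that the pieces' texts,
the vocabulary of `…StabilisationData.lean` and the landed reductions compose: after this file the N3
debt is exactly N3d-0, N3d-1, N3d-2, N3d-3, N3d-4/5/6 and N1. [cite: Baykur2006, Lemma 1] -/
theorem stgeo_of_pieces_of_M2geo
    (h1 : ∀ (g n : ℕ) (c : Fin g ⊕ Fin g → ℤ), (c = 0 ∨ IsPrimitive c) → Nonempty (StabBaseData g n c))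
    (h0 : ∀ (M : Type) [TopologicalSpace M] [T2Space M] [SecondCountableTopology M]
      [ChartedSpace (EuclideanSpace ℝ (Fin 4)) M] [IsManifold (𝓡 4) ∞ M] (g : ℕ) (l : IntWord g)
      (c : Fin g ⊕ Fin g → ℤ) (S : StabBaseData g l.length c),
      ModelsOnFibred M g l → NormalisedDatum M g l S)
    (h2 : ∀ (g n : ℕ) (c : Fin g ⊕ Fin g → ℤ) (S : StabBaseData g n c)
      (V : Type) [TopologicalSpace V] [T2Space V] [SecondCountableTopology V] [CompactSpace V]
      [ChartedSpace (EuclideanHalfSpace 4) V] [IsManifold (𝓡∂ 4) ∞ V]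
      (DV : MultiAttachmentData ![S.qA, S.qB] (𝓡∂ 4) V),
      ∃ Λ : V ≃ₘ⟮𝓡∂ 4, 𝓡∂ 4⟯ Base g,
        ∀ (a : ↥(coresComplement S.q1)) (ha : S.E.jA a ∈ coresComplement ![S.qA, S.qB]),
          (a : Base g) ∉ modelRegion g n S.δ₀ S.ε₁ → Λ (DV.jA ⟨S.E.jA a, ha⟩) = (a : Base g))
    (h3 : ∀ (M : Type) [TopologicalSpace M] [T2Space M] [SecondCountableTopology M]
      [ChartedSpace (EuclideanSpace ℝ (Fin 4)) M] [IsManifold (𝓡 4) ∞ M] (g : ℕ) (l : IntWord g)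
      (c : Fin g ⊕ Fin g → ℤ) (S : StabBaseData g l.length c),
      NormalisedDatum M g l S →
      (∀ (V : Type) [TopologicalSpace V] [T2Space V] [SecondCountableTopology V] [CompactSpace V]
        [ChartedSpace (EuclideanHalfSpace 4) V] [IsManifold (𝓡∂ 4) ∞ V]
        (DV : MultiAttachmentData ![S.qA, S.qB] (𝓡∂ 4) V),
        ∃ Λ : V ≃ₘ⟮𝓡∂ 4, 𝓡∂ 4⟯ Base g,
          ∀ (a : ↥(coresComplement S.q1)) (ha : S.E.jA a ∈ coresComplement ![S.qA, S.qB]),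
            (a : Base g) ∉ modelRegion g l.length S.δ₀ S.ε₁ → Λ (DV.jA ⟨S.E.jA a, ha⟩) = (a : Base g)) →
      TwoSidedStabModel M g l S)
    (h4 : ∀ (M : Type) [TopologicalSpace M] [T2Space M] [SecondCountableTopology M]
      [ChartedSpace (EuclideanSpace ℝ (Fin 4)) M] [IsManifold (𝓡 4) ∞ M] (g : ℕ) (l : IntWord g)
      (c : Fin g ⊕ Fin g → ℤ) (S : StabBaseData g l.length c),
      TwoSidedStabModel M g l S → ModelsOnFibred M (g + 1) (natWord g c l))
    (hM2 : ∀ (g : ℕ) (l l' : IntWord g), HurwitzStep (stdSymp ℤ g) l l' →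
      ∀ (X : Type) [TopologicalSpace X] [T2Space X] [SecondCountableTopology X] [CompactSpace X]
        [ChartedSpace (EuclideanHalfSpace 4) X] [IsManifold (𝓡∂ 4) ∞ X]
        (h : Fin l.length → HandleAttachingMap 3 2 (Base g))
        (D : MultiAttachmentData h (𝓡∂ 4) X) (bX : BoundaryData (𝓡∂ 4) X (𝓡 3))
        (Ψ : bX.carrier ≃ₘ⟮𝓡 3, 𝓡 3⟯ (bBase g).carrier),
        IsLefschetzLink g l h →
        (∀ (y : bX.carrier) (a : ↥(coresComplement h)), bX.incl y = D.jA a →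
          ∃ c : ℝ, 0 < c ∧ w g ((bBase g).incl (Ψ y)).1 = (c : ℂ) * w g (a : Base g).1) →
        ∃ (X' : Type) (_ : TopologicalSpace X') (_ : T2Space X') (_ : SecondCountableTopology X')
          (_ : CompactSpace X') (_ : ChartedSpace (EuclideanHalfSpace 4) X')
          (_ : IsManifold (𝓡∂ 4) ∞ X') (h' : Fin l'.length → HandleAttachingMap 3 2 (Base g))
          (D' : MultiAttachmentData h' (𝓡∂ 4) X') (G : X ≃ₘ⟮𝓡∂ 4, 𝓡∂ 4⟯ X'),
          IsLefschetzLink g l' h' ∧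
          ∀ a' : ↥(coresComplement h'), G.symm (D'.jA a') ∈ (𝓡∂ 4).boundary X →
            (∃ a : ↥(coresComplement h), G.symm (D'.jA a') = D.jA a ∧
              ∃ c : ℝ, 0 < c ∧ w g (a' : Base g).1 = (c : ℂ) * w g (a : Base g).1) ∨
            (∃ (k : Fin l.length) (b : ↥(beltPiece 3 2)), G.symm (D'.jA a') = D.jB k b ∧
              G.symm (D'.jA a') ∉ range D.jA ∧
              ∃ c : ℝ, 0 < c ∧ w g (a' : Base g).1 = (c : ℂ) * pageDir l.length k)) :
    ∀ (g : ℕ) (l : Literature.GroupTheory.CombinatorialGroupTheory.SignedHurwitz.IntWord g) (c : Fin g ⊕ Fin g → ℤ), (c = 0 ∨ Literature.GroupTheory.CombinatorialGroupTheory.SignedHurwitz.IsPrimitive c) → ∀ (X : Type) [TopologicalSpace X] [T2Space X] [SecondCountableTopology X] [CompactSpace X] [ChartedSpace (EuclideanHalfSpace 4) X] [IsManifold (𝓡∂ 4) ∞ X] (h : Fin l.length → Literature.Topology.FourManifolds.HandleAttachingMap 3 2 (Literature.Topology.FourManifolds.LefschetzBase.Base g)) (D : Literature.Topology.FourManifolds.HandleAttachingMap.MultiAttachmentData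 h (𝓡∂ 4) X) (bX : Literature.Topology.FourManifolds.BoundaryData (𝓡∂ 4) X (𝓡 3)) (Ψ : bX.carrier ≃ₘ⟮𝓡 3, 𝓡 3⟯ (Literature.Topology.FourManifolds.LefschetzBase.bBase g).carrier), Literature.Topology.FourManifolds.LefschetzBase.IsLefschetzLink g l h → (∀ (y : bX.carrier) (a : ↥(Literature.Topology.FourManifolds.HandleAttachingMap.coresComplement h)), bX.incl y = D.jA a → ∃ c : ℝ, 0 < c ∧ Literature.Topology.FourManifolds.LefschetzBase.w g ((Literature.Topology.FourManifolds.LefschetzBase.bBase g).incl (Ψ y)).1 = (c : ℂ) * Literature.Topology.FourManifolds.LefschetzBase.w g (a : Literature.Topology.FourManifolds.LefschetzBase.Base g).1) → ∃ (X' : Type) (_ : TopologicalSpace X') (_ : T2Space X') (_ : SecondCountableTopology X') (_ : CompactSpace X') (_ : ChartedSpace (EuclideanHalfSpace 4) X') (_ : IsManifold (𝓡∂ 4) ∞ X') (h' : Fin (Literature.GroupTheory.CombinatorialGroupTheory.SignedHurwitz.stabBlock g c ++ Literature.GroupTheory.CombinatorialGroupTheory.SignedHurwitz.mapWord (Literature.GroupTheory.CombinatorialGroupTheory.SignedHurwitz.embed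 g) l).length → Literature.Topology.FourManifolds.HandleAttachingMap 3 2 (Literature.Topology.FourManifolds.LefschetzBase.Base (g + 1))) (D' : Literature.Topology.FourManifolds.HandleAttachingMap.MultiAttachmentData h' (𝓡∂ 4) X') (bX' : Literature.Topology.FourManifolds.BoundaryData (𝓡∂ 4) X' (𝓡 3)) (Ψ' : bX'.carrier ≃ₘ⟮𝓡 3, 𝓡 3⟯ (Literature.Topology.FourManifolds.LefschetzBase.bBase (g + 1)).carrier), Literature.Topology.FourManifolds.LefschetzBase.IsLefschetzLink (g + 1) (Literature.GroupTheory.CombinatorialGroupTheory.SignedHurwitz.stabBlock g c ++ Literature.GroupTheory.CombinatorialGroupTheory.SignedHurwitz.mapWord (Literature.GroupTheory.CombinatorialGroupTheory.SignedHurwitz.embed g) l) h' ∧ (∀ (y : bX'.carrier) (a : ↥(Literature.Topology.FourManifolds.HandleAttachingMap.coresComplement h')), bX'.incl y = D'.jA a → ∃ c' : ℝ, 0 < c' ∧ Literature.Topology.FourManifolds.LefschetzBase.w (g + 1) ((Literature.Topology.FourManifolds.LefschetzBase.bBase (g + 1)).incl (Ψ' y)).1 = (c' : ℂ) * Literature.Topology.FourManifolds.LefschetzBase.w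 (g + 1) (a : Literature.Topology.FourManifolds.LefschetzBase.Base (g + 1)).1) ∧ ∀ (M M' : Type) [TopologicalSpace M] [ChartedSpace (EuclideanSpace ℝ (Fin 4)) M] [IsManifold (𝓡 4) ∞ M] [TopologicalSpace M'] [ChartedSpace (EuclideanSpace ℝ (Fin 4)) M'] [IsManifold (𝓡 4) ∞ M'], Literature.Topology.FourManifolds.IsBoundaryGluing bX (Literature.Topology.FourManifolds.LefschetzBase.bBase g) Ψ (𝓡 4) M → Literature.Topology.FourManifolds.IsBoundaryGluing bX' (Literature.Topology.FourManifolds.LefschetzBase.bBase (g + 1)) Ψ' (𝓡 4) M' → Nonempty (M ≃ₘ⟮𝓡 4, 𝓡 4⟯ M') :=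
  StabNaturalReduction.stgeo_of_natural_of_M2geo (node_STnat_of_pieces h1 h0 h2 h3 h4) hM2

end StabilisationData

/-! ## Registered helper -/

/-- **Registered helper `helper_node_STnat_of_four` (sub-goal of `stub_STgeo` ▸ N3-nat, wave 7, lead c5):
N3-nat — a fibred model of `M` over `Base g` with word `l` and a primitive-or-zero arc class `c` give a
fibred model of the same `M` over `Base (g+1)` with the natural word `natWord g c l` — FROM the
stabilised base data (N3d-1), the normalisation of fibred data (N3d-0), the rebase to the two-sided model
(N3d-3 with the cancellations N3d-2 already supplied, cf. `node_STnat_of_pieces` for the five-piece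
form) and the trading/finish (N3d-4/5/6).** [cite: EtnyreFuller2006, §2] -/
theorem helper_node_STnat_of_four : (∀ (g n : ℕ) (c : Fin g ⊕ Fin g → ℤ), (c = 0 ∨ Literature.GroupTheory.CombinatorialGroupTheory.SignedHurwitz.IsPrimitive c) → Nonempty (Summit.SmoothPoincare4.SmoothPoincare4.Theorems.AcyclicBisectionExists.ModpBraidOrbits.StabBaseData g n c)) → (∀ (M : Type) [TopologicalSpace M] [T2Space M] [SecondCountableTopology M] [ChartedSpace (EuclideanSpace ℝ (Fin 4)) M] [IsManifold (𝓡 4) ∞ M] (g : ℕ) (l : Literature.GroupTheory.CombinatorialGroupTheory.SignedHurwitz.IntWord g) (c : Fin g ⊕ Fin g → ℤ) (S : Summit.SmoothPoincare4.SmoothPoincare4.Theorems.AcyclicBisectionExists.ModpBraidOrbits.StabBaseData g l.length c), Literature.Topology.FourManifolds.LefschetzBase.ModelsOnFibred M g l → Summit.SmoothPoincare4.SmoothPoincare4.Theorems.AcyclicBisectionExists.ModpBraidOrbits.NormalisedDatum M g l S) → (∀ (M : Type) [TopologicalSpace M] [T2Space M] [SecondCountableTopology M] [ChartedSpace (EuclideanSpace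 ℝ (Fin 4)) M] [IsManifold (𝓡 4) ∞ M] (g : ℕ) (l : Literature.GroupTheory.CombinatorialGroupTheory.SignedHurwitz.IntWord g) (c : Fin g ⊕ Fin g → ℤ) (S : Summit.SmoothPoincare4.SmoothPoincare4.Theorems.AcyclicBisectionExists.ModpBraidOrbits.StabBaseData g l.length c), Summit.SmoothPoincare4.SmoothPoincare4.Theorems.AcyclicBisectionExists.ModpBraidOrbits.NormalisedDatum M g l S → Summit.SmoothPoincare4.SmoothPoincare4.Theorems.AcyclicBisectionExists.ModpBraidOrbits.TwoSidedStabModel M g l S) → (∀ (M : Type) [TopologicalSpace M] [T2Space M] [SecondCountableTopology M] [ChartedSpace (EuclideanSpace ℝ (Fin 4)) M] [IsManifold (𝓡 4) ∞ M] (g : ℕ) (l : Literature.GroupTheory.CombinatorialGroupTheory.SignedHurwitz.IntWord g) (c : Fin g ⊕ Fin g → ℤ) (S : Summit.SmoothPoincare4.SmoothPoincare4.Theorems.AcyclicBisectionExists.ModpBraidOrbits.StabBaseData g l.length c), Summit.SmoothPoincare4.SmoothPoincare4.Theorems.AcyclicBisectionExists.ModpBraidOrbits.TwoSidedStabModel M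 g l S → Literature.Topology.FourManifolds.LefschetzBase.ModelsOnFibred M (g + 1) (Summit.SmoothPoincare4.SmoothPoincare4.Theorems.AcyclicBisectionExists.ModpBraidOrbits.natWord g c l)) → ∀ (M : Type) [TopologicalSpace M] [T2Space M] [SecondCountableTopology M] [ChartedSpace (EuclideanSpace ℝ (Fin 4)) M] [IsManifold (𝓡 4) ∞ M] (g : ℕ) (l : Literature.GroupTheory.CombinatorialGroupTheory.SignedHurwitz.IntWord g) (c : Fin g ⊕ Fin g → ℤ), (c = 0 ∨ Literature.GroupTheory.CombinatorialGroupTheory.SignedHurwitz.IsPrimitive c) → Literature.Topology.FourManifolds.LefschetzBase.ModelsOnFibred M g l → Literature.Topology.FourManifolds.LefschetzBase.ModelsOnFibred M (g + 1) (Summit.SmoothPoincare4.SmoothPoincare4.Theorems.AcyclicBisectionExists.ModpBraidOrbits.natWord g c l) :=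
  fun h1 h0 h23 h4 M _ _ _ _ _ g l c hc hM => by
    obtain ⟨S⟩ := h1 g l.length c hc
    exact h4 M g l c S (h23 M g l c S (h0 M g l c S hM))

end Summit.SmoothPoincare4.SmoothPoincare4.Theorems.AcyclicBisectionExists.ModpBraidOrbits

end
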